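import Literature.AlgebraicGeometry.HodgeTheory.CrossProductsGenericDivisibility
import Literature.AlgebraicGeometry.Motives.ProjectiveSpaceComplexPointsGradedBasis
import Summits.HodgeConjecture.HodgeConjecture.Theorems.GenericDivisibilityHodgeClassesGenericallyDivisibleAboveDim

/-!
# Route GenericDivisibility — crux `HodgeClassesGenericallyDivisible` (C1, item stmt-HodgeConjecture-18466):
# C1 holds for EVERY integral class on `Y ⊗ ℙ¹`, unconditionally and Hodge-blind

For `Y` a smooth projective complex `(2p-1)`-fold, the `2p`-fold `X = Y ⊗ ℙ¹_ℂ` satisfies the crux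
C1 for EVERY class `z ∈ H²ᵖ(X(ℂ); ℤ)` — of Hodge type `(p,p)` or not — and in the strong form
`z|_{(X∖Z)(ℂ)} = 0` (so `y = 0` serves every `m`): by the integral Künneth theorem for
`(Y ⊗ ℙ¹)(ℂ)` (`HodgeTheory/CrossProductsGenericDivisibility` with the graded basis `1, x` of
`H*(ℙ¹_ℂ(ℂ); ℤ)`, `Motives/ProjectiveSpaceComplexPointsGradedBasis`),
`z = pr_Y^* a₀ ⌣ pr_ℙ^* 1 + pr_Y^* a₁ ⌣ pr_ℙ^* x` with `a₀ ∈ H²ᵖ(Y(ℂ); ℤ)`, `a₁ ∈ H²ᵖ⁻²(Y(ℂ); ℤ)`;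
`a₀` dies on the complex points of a non-empty Zariski open of `Y` (`2p > dim Y`: the sharp
`AboveDimGenericallyZero` = Andreotti–Frankel, `stub_aboveDimGenericallyZero_sharp`), and
`x ∈ H²(ℙ¹(ℂ); ℤ)` dies on `ℙ¹ ∖ pt` (same theorem, `2 > 1`); the product descent
(`exists_restrictToCompl_eq_nsmul_of_gradedBasis` with `μ = 0`) then kills `z` on the complex points
of a non-empty product open of `Y ⊗ ℙ¹`:

* `genericDivisibility_tensorProjectiveLine_restrict_eq_zero` — the strong form (`z| = 0`);
* `stub_hodgeClassesGenericallyDivisible_tensorProjectiveLine` — the registered sub-goal of the item: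
  its statement for `X = Y ⊗ ℙ¹` with NO Hodge-type hypothesis.

Remarks. (i) The Hodge conjecture on such `X` in degree `2p` is HC for `Y` in degrees `2p` and
`2p - 2`, i.e. `dim Y ± 1` — not known in general — so this is a family of `2p`-folds on which C1 is
settled while the rational statement behind it is open; (ii) it is also a constraint for refuters:
a witness against "C1 without the `(p,p)` hypothesis" cannot live on a product with `ℙ¹`.
The crux itself (all `(p,p)`-classes on all `2p`-folds, `p ≥ 2`) is untouched (open problem).

References: A. Hatcher, *Algebraic Topology* (2002), Thm. 3.16, Thm. 3.19, Prop. 3.10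
[HatcherAT2002]; A. Andreotti, T. Frankel, *The Lefschetz theorem on hyperplane sections*, Ann. of
Math. 69 (1959), Thm. 1 [AndreottiFrankel1959]; A. Grothendieck, Topology 8 (1969), §1
[GrothendieckTopology1969].
-/

set_option linter.dupNamespace false

noncomputable section

namespace Summit.HodgeConjecture.HodgeConjecture.Theorems

open CategoryTheory MonoidalCategory
open Literature.AlgebraicGeometry.Motives Literature.AlgebraicGeometry.HodgeTheory
  Literature.AlgebraicTopology.SingularHomology
open Summit.HodgeConjecture.HodgeConjecture.Theses.GenericDivisibility

/-- **Every integral class of degree `> dim Y` on `Y ⊗ ℙ¹` dies on a non-empty Zariski open.** For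
`Y` smooth projective over `ℂ` of dimension `d`, `k > d` and `z ∈ Hᵏ((Y ⊗ ℙ¹)(ℂ); ℤ)` there is a
Zariski-closed `Z ⊊ Y ⊗ ℙ¹` with `z|_{((Y ⊗ ℙ¹)∖Z)(ℂ)} = 0`: Künneth along the graded basis `1, x` of
`H*(ℙ¹(ℂ); ℤ)`, Andreotti–Frankel on `Y` for the coefficient of `1` (degree `k > d`) and on
`ℙ¹ ∖ pt` for `x`, and the product descent. [cite: HatcherAT2002, §3.2 Thm. 3.16 and Thm. 3.19]
[cite: AndreottiFrankel1959, Thm. 1] [cite: GrothendieckTopology1969, §1] -/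
theorem genericDivisibility_tensorProjectiveLine_restrict_eq_zero {d : ℕ} {Y : SchemeOver ℂ}
    (hY : IsSmoothProjective d Y) {k : ℕ} (hk : d < k)
    (z : singularCohomology ℤ ℤ (ComplexPoints (Y ⊗ projectiveSpace 1 ℂ)) k) :
    ∃ Z : Set (Y ⊗ projectiveSpace 1 ℂ).left, IsClosed Z ∧ Z ≠ Set.univ ∧
      singularCohomology.map ℤ ℤ
        (⟨Subtype.val, continuous_subtype_val⟩ :
          C(complexPointsCompl (Y ⊗ projectiveSpace 1 ℂ) Z, ComplexPoints (Y ⊗ projectiveSpace 1 ℂ)))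
        k z = 0 := by
  have hP : IsSmoothProjective 1 (projectiveSpace 1 ℂ) := isSmoothProjective_projectiveSpace_holds ℂ 1
  obtain ⟨e, he⟩ := ComplexPoints.projectiveSpace_exists_gradedBasis ℤ 1
  -- degree `0`: the coefficient lives in `Hᵏ(Y(ℂ); ℤ)`, `k > dim Y`; degree `2`: `x` dies off a point
  have hyp : ∀ j : Fin (1 + 1), LerayHirsch.evenDeg (1 + 1) j ≤ k →
      (∃ T : Set (projectiveSpace 1 ℂ).left, IsClosed T ∧ T ≠ Set.univ ∧
        restrictToCompl ℤ (projectiveSpace 1 ℂ) (LerayHirsch.evenDeg (1 + 1) j) T (e j) = 0) ∨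
      (∀ x : singularCohomology ℤ ℤ (ComplexPoints Y) (k - LerayHirsch.evenDeg (1 + 1) j),
        ∃ S : Set Y.left, IsClosed S ∧ S ≠ Set.univ ∧
          ∃ y : singularCohomology ℤ ℤ (complexPointsCompl Y S) (k - LerayHirsch.evenDeg (1 + 1) j),
            restrictToCompl ℤ Y (k - LerayHirsch.evenDeg (1 + 1) j) S x = 0 • y) := by
    intro j _
    by_cases hj0 : (j : ℕ) = 0
    · refine Or.inr fun x ↦ ?_
      have hk' : d < k - LerayHirsch.evenDeg (1 + 1) j := by
        change d < k - 2 * (j : ℕ)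
        omega
      obtain ⟨S, hS, hSne, hx⟩ := stub_aboveDimGenericallyZero_sharp hY hk' x
      exact ⟨S, hS, hSne, 0, by rw [nsmul_zero]; exact hx⟩
    · refine Or.inl ?_
      have h2 : 1 < LerayHirsch.evenDeg (1 + 1) j := by
        change 1 < 2 * (j : ℕ)
        omega
      exact stub_aboveDimGenericallyZero_sharp hP h2 (e j)
  obtain ⟨D, hD, hDne, w, hw⟩ := exists_restrictToCompl_eq_nsmul_of_gradedBasis ℤ hY hP
    (LerayHirsch.evenDeg (1 + 1)) e he (k := k) 0 hyp z
  exact ⟨D, hD, hDne, by rw [← zero_nsmul w]; exact hw⟩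

/-- **Registered sub-goal `stub_hodgeClassesGenericallyDivisible_tensorProjectiveLine` of the crux
item stmt-HodgeConjecture-18466** — the item's statement for the `2p`-folds `X = Y ⊗ ℙ¹_ℂ`
(`Y` smooth projective of dimension `2p - 1`) with NO Hodge-type hypothesis: for every
`z ∈ H²ᵖ(X(ℂ); ℤ)` and `m ≥ 1` there are a proper Zariski-closed `Z` and `y` (namely `0`) with
`m • y = z|_{(X∖Z)(ℂ)}` (`genericDivisibility_tensorProjectiveLine_restrict_eq_zero`).
[cite: HatcherAT2002, §3.2 Thm. 3.16 and Thm. 3.19] [cite: AndreottiFrankel1959, Thm. 1] -/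
theorem stub_hodgeClassesGenericallyDivisible_tensorProjectiveLine :
    ∀ ⦃p : ℕ⦄ ⦃Y : SchemeOver ℂ⦄, 1 ≤ p → IsSmoothProjective (2 * p - 1) Y →
      ∀ z : singularCohomology ℤ ℤ
        (ComplexPoints (CategoryTheory.MonoidalCategoryStruct.tensorObj Y (projectiveSpace 1 ℂ))) (2 * p),
        ∀ m : ℕ, 1 ≤ m →
          ∃ Z : Set (CategoryTheory.MonoidalCategoryStruct.tensorObj Y (projectiveSpace 1 ℂ)).left,
            IsClosed Z ∧ Z ≠ Set.univ ∧
            ∃ y : singularCohomology ℤ ℤ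
              (complexPointsCompl (CategoryTheory.MonoidalCategoryStruct.tensorObj Y (projectiveSpace 1 ℂ)) Z) (2 * p),
              m • y = singularCohomology.map ℤ ℤ
                (⟨Subtype.val, continuous_subtype_val⟩ :
                  C(complexPointsCompl (CategoryTheory.MonoidalCategoryStruct.tensorObj Y (projectiveSpace 1 ℂ)) Z,
                    ComplexPoints (CategoryTheory.MonoidalCategoryStruct.tensorObj Y (projectiveSpace 1 ℂ)))) (2 * p) z := by
  intro p Y hp hY z m _
  obtain ⟨Z, hZ, hZne, h0⟩ :=
    genericDivisibility_tensorProjectiveLine_restrict_eq_zero hY (show 2 * p - 1 < 2 * p by omega) z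
  exact ⟨Z, hZ, hZne, 0, by rw [nsmul_zero]; exact h0.symm⟩

end Summit.HodgeConjecture.HodgeConjecture.Theorems

end
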